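import Summits.NavierStokesRegularity.NavierStokesRegularity.Theorems.SoloRefuteSmith2006ComparisonCalc

/-!
# D-0090 NS-CLAIMS, claim C06 `Smith2006` (#14) — DOWNSTREAM ADDENDUM: the comparison principle as invoked is false

Cell `ns-claims`; refuter `ns-claims-refuter-4` (g3) (row of record: refuter-3 g0 / refuter-2 g3; typist
`ns-claims-typist-12`, referee `ns-claims-ref-2`). The theorems below NEGATE `ComparisonAuxClassical`,
`ComparisonAuxClassicalFlipped` and, for every `PViscosityNotion`, `ComparisonAux vn` of
`Literature.Claims.NS.Smith2006` — the comparison principle [Sm3] Thm 4 (Smith, «On Perron's method for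
general systems of PDE's», p. 10, with the Remark p. 11 that classical `C² ∩ H^{2,2}` bounded fields with the
right residual sign are sub/supersolutions) AS APPLIED in the proof of Thm 4 p. 4 l. 364–367 of Smith 2006
(«Immortal smooth solution of the three space dimensional Navier–Stokes system», arXiv:math/0608458) to the
λ-system (6): «This follows by applying (for each λ) the comparison principle given as Theorem 4 of [SM3]».
The adjudicated token of record (#14, unfilled gap @ Thm 4) is unchanged; this file records that the
second input of `theorem4Bounds_of_barriers_comparison` fails for classical comparands.

## Countermodel (`not_ComparisonAuxClassical`)

`λ = 1/8`, `t̂ = 0`, `S = [0,1]`, `F = 0`, `W₀ = 0`, `V₂ = 0`, and `V₁ = V_c` with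
`vᵢ = a(t)∂ᵢψ`, `Υᵢₖ = t³∂ₖ∂ᵢψ + δᵢₖ c t χ`, `P = t³Δψ − a′ψ − (a²/2)|∇ψ|² + c t χ`, where `a = t³ + 3λt²`
(so `λ(t³)′ + t³ = a`), `ψ` is a smooth bump, `χ` a wider bump equal to `1` on `supp ψ`, and
`c = c₀ = 14 sup|Δψ| + 7 + 6 sup|∇ψ|²`. Then on `[0,1] × ℝ³`: the `Υᵢₖ`-rows of `L_λ(V₁)` equal
`δᵢₖ c(λ + t)χ ≥ 0`; the `vᵢ`-rows vanish identically (`v` is a gradient, `v·∇vᵢ = (a²/2)∂ᵢ|∇ψ|²` and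
`∑ₖ∂ₖΥᵢₖ = t³∂ᵢΔψ + c t ∂ᵢχ` are absorbed by `∂ᵢP`); the `p`-row equals
`(3λt² + a)Δψ − λa″ψ − λaa′|∇ψ|² + λcχ ≥ 0` by the choice of `c`. All components are smooth, supported in
`‖x‖ ≤ 3`, and vanish at `t = 0`; `V₂ = 0` has zero residual. The conclusion `V₂ ≤ V₁` on the slab fails
at `t = 1` where `∂₀ψ < 0` (`v₀ = a(1)∂₀ψ < 0`). Exchanging the roles refutes the literal-sign variant.
(System (6) is a symmetric-hyperbolic relaxation system; no maximum principle orders its classical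
super- and subsolutions.)

WHAT THIS IS NOT: not a claim about NS regularity or blow-up; not a claim about any author beyond the typed
locator.
-/

-- The summit's canonical theorem namespace repeats the summit name (single-conjunct summit).
set_option linter.dupNamespace false

noncomputable section

open Set Function MeasureTheory Metric Filter
open scoped ContDiff ENNReal Topology

namespace Summit.NavierStokesRegularity.NavierStokesRegularity.Theorems.Smith2006

open Literature.Claims.NS.Smith2006

/-! ### The witness: a classical supersolution of the homogeneous λ-system with zero data that changes sign -/

/-- The relaxation parameter used: `λ₀ = 1/8 ∈ (0, 1/4)`. [folklore] -/
def lam0 : ℝ := 1 / 8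

/-- `0 < λ₀`. [folklore] -/
theorem lam0_pos : 0 < lam0 := by norm_num [lam0]

/-- `λ₀ < 1/4`. [folklore] -/
theorem lam0_lt : lam0 < 1 / 4 := by norm_num [lam0]

/-- Kronecker delta on `Fin 3`. [folklore] -/
def δ (i k : Fin 3) : ℝ := if i = k then 1 else 0

/-- `δᵢₖ ≥ 0`. [folklore] -/
theorem δ_nonneg (i k : Fin 3) : 0 ≤ δ i k := by unfold δ; split_ifs <;> norm_num

/-- The `p`-slot of the witness: `P = θΔψ − a′ψ − (a²/2)|∇ψ|² + c t χ`. [folklore] -/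
def wP (c t : ℝ) (x : R3) : ℝ :=
  θ t * Lψ x - a1 lam0 t * ψ x - a lam0 t * a lam0 t / 2 * Gψ x + c * t * χ x

/-- The velocity slots of the witness: `vᵢ = a ∂ᵢψ` (a gradient field). [folklore] -/
def wv (t : ℝ) (x : R3) (i : Fin 3) : ℝ := a lam0 t * dψ i x

/-- The gradient slots of the witness: `Υᵢₖ = θ ∂ₖ∂ᵢψ + δᵢₖ c t χ`. [folklore] -/
def wΥ (c t : ℝ) (x : R3) (i k : Fin 3) : ℝ := θ t * ddψ i k x + δ i k * (c * t * χ x)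

/-- The witness field `V_c = (P, v, Υ)`. [folklore] -/
def wit (c : ℝ) : AuxField := ⟨wP c, wv, wΥ c⟩

/-- The zero field (the other comparand). [folklore] -/
def zeroField : AuxField := ⟨fun _ _ => 0, fun _ _ _ => 0, fun _ _ _ _ => 0⟩

/-! ### Derivatives of the witness components -/

/-- `∂ₜP`. [folklore] -/
theorem hasDerivAt_wP (c t : ℝ) (x : R3) :
    HasDerivAt (fun s => wP c s x)
      (3 * t ^ 2 * Lψ x - a2 lam0 t * ψ x - a lam0 t * a1 lam0 t * Gψ x + c * χ x) t := by
  have h : HasDerivAt (fun s => θ s * Lψ x - a1 lam0 s * ψ x - a lam0 s * a lam0 s / 2 * Gψ x + c * s * χ x)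
      (3 * t ^ 2 * Lψ x - a2 lam0 t * ψ x - (a1 lam0 t * a lam0 t + a lam0 t * a1 lam0 t) / 2 * Gψ x
        + c * 1 * χ x) t :=
    ((((hasDerivAt_θ t).mul_const _).sub ((hasDerivAt_a1 lam0 t).mul_const _)).sub
      ((((hasDerivAt_a lam0 t).mul (hasDerivAt_a lam0 t)).div_const 2).mul_const _)).add
      (((hasDerivAt_id t).const_mul c).mul_const _)
  exact h.congr_deriv (by ring)

/-- `∂ₜvᵢ`. [folklore] -/
theorem hasDerivAt_wv (t : ℝ) (x : R3) (i : Fin 3) :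
    HasDerivAt (fun s => wv s x i) (a1 lam0 t * dψ i x) t := by
  have h : HasDerivAt (fun s => a lam0 s * dψ i x) (a1 lam0 t * dψ i x) t := (hasDerivAt_a lam0 t).mul_const _
  exact h

/-- `∂ₜΥᵢₖ`. [folklore] -/
theorem hasDerivAt_wΥ (c t : ℝ) (x : R3) (i k : Fin 3) :
    HasDerivAt (fun s => wΥ c s x i k) (3 * t ^ 2 * ddψ i k x + δ i k * (c * χ x)) t := by
  have h : HasDerivAt (fun s => θ s * ddψ i k x + δ i k * (c * s * χ x))
      (3 * t ^ 2 * ddψ i k x + δ i k * (c * 1 * χ x)) t :=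
    ((hasDerivAt_θ t).mul_const _).add ((((hasDerivAt_id t).const_mul c).mul_const _).const_mul _)
  exact h.congr_deriv (by ring)

/-- `∂ₖvᵢ = a ∂ₖ∂ᵢψ`. [folklore] -/
theorem pd_wv (t : ℝ) (x : R3) (i k : Fin 3) : pd (fun y => wv t y i) k x = a lam0 t * ddψ i k x := by
  show pd (fun y => a lam0 t * dψ i y) k x = _
  rw [pd_const_mul ((contDiff_dψ i).differentiable (by simp) x)]; rfl

/-- `∂ᵢP`. [folklore] -/
theorem pd_wP (c t : ℝ) (x : R3) (i : Fin 3) :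
    pd (wP c t) i x =
      θ t * pd Lψ i x - a1 lam0 t * dψ i x - a lam0 t * a lam0 t / 2 * pd Gψ i x + c * t * pd χ i x := by
  have h : HasFDerivAt (wP c t)
      ((θ t) • fderiv ℝ Lψ x - (a1 lam0 t) • fderiv ℝ ψ x - (a lam0 t * a lam0 t / 2) • fderiv ℝ Gψ x
        + (c * t) • fderiv ℝ χ x) x :=
    ((((hasFDerivAt_of_smooth contDiff_Lψ x).const_mul (θ t)).sub
      ((hasFDerivAt_of_smooth (contDiffAll_ψ ⊤) x).const_mul (a1 lam0 t))).sub
      ((hasFDerivAt_of_smooth contDiff_Gψ x).const_mul _)).add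
      ((hasFDerivAt_of_smooth (contDiffAll_χ ⊤) x).const_mul (c * t))
  rw [pd_of_hasFDerivAt h i]
  simp [pd, dψ]

/-- `∂ⱼΥᵢₖ`. [folklore] -/
theorem pd_wΥ (c t : ℝ) (x : R3) (i k j : Fin 3) :
    pd (fun y => wΥ c t y i k) j x = θ t * pd (ddψ i k) j x + δ i k * (c * t * pd χ j x) := by
  have h : HasFDerivAt (fun y => wΥ c t y i k)
      ((θ t) • fderiv ℝ (ddψ i k) x + (δ i k) • (c * t) • fderiv ℝ χ x) x :=
    ((hasFDerivAt_of_smooth (contDiff_ddψ i k) x).const_mul (θ t)).add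
      (((hasFDerivAt_of_smooth (contDiffAll_χ ⊤) x).const_mul (c * t)).const_mul (δ i k))
  rw [pd_of_hasFDerivAt h j]
  simp [pd]

/-! ### The residual rows of the witness (`F = 0`, `S = [0, 1]`, `λ = λ₀`) -/

/-- The `Υᵢⱼ`-row of the witness: `δᵢⱼ c (λ₀ + t) χ` (the `∂ₖ∂ᵢψ` terms cancel since `λ₀θ′ + θ = a`).
[folklore] -/
theorem residualΥ_wit (c : ℝ) {t : ℝ} (ht : t ∈ Icc (0 : ℝ) 1) (x : R3) (i j : Fin 3) :
    auxResidualΥ lam0 (Icc 0 1) (wit c) t x i j = δ i j * c * (lam0 + t) * χ x := by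
  simp only [auxResidualΥ, wit]
  rw [(hasDerivAt_wΥ c t x i j).hasDerivWithinAt.derivWithin (uniqueDiffOn_Icc zero_lt_one t ht), pd_wv]
  simp only [wΥ, θ, a]
  ring

/-- The `vᵢ`-rows of the witness vanish identically: `∂ₜvᵢ + v·∇vᵢ + ∂ᵢP − ∑ₖ∂ₖΥᵢₖ = a′∂ᵢψ + (a²/2)∂ᵢ|∇ψ|²
+ ∂ᵢ(θΔψ − a′ψ − (a²/2)|∇ψ|² + ctχ) − θ∂ᵢΔψ − ct∂ᵢχ = 0` by (I1), (I2). [folklore] -/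
theorem residualV_wit (c : ℝ) {t : ℝ} (ht : t ∈ Icc (0 : ℝ) 1) (x : R3) (i : Fin 3) :
    auxResidualV AuxForce.zero (Icc 0 1) (wit c) t x i = 0 := by
  have hsum1 : ∑ k, wv t x k * pd (fun y => wv t y i) k x = a lam0 t * a lam0 t / 2 * pd Gψ i x := by
    rw [pd_Gψ, ← mul_assoc, Finset.mul_sum]
    refine Finset.sum_congr rfl fun k _ => ?_
    rw [pd_wv]; simp only [wv]; ring
  have hsum2 : ∑ k, pd (fun y => wΥ c t y i k) k x = θ t * pd Lψ i x + c * t * pd χ i x := by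
    simp only [pd_wΥ]
    rw [Finset.sum_add_distrib, pd_Lψ, Finset.mul_sum]
    congr 1
    simp [δ, Finset.sum_ite_eq]
  simp only [auxResidualV, wit]
  rw [(hasDerivAt_wv t x i).hasDerivWithinAt.derivWithin (uniqueDiffOn_Icc zero_lt_one t ht), hsum1, pd_wP,
    hsum2]
  simp only [AuxForce.zero]
  ring

/-- The `p`-row of the witness: `(3λ₀t² + a)Δψ − λ₀a″ψ − λ₀aa′|∇ψ|² + λ₀cχ`. [folklore] -/
theorem residualP_wit (c : ℝ) {t : ℝ} (ht : t ∈ Icc (0 : ℝ) 1) (x : R3) :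
    auxResidualP lam0 AuxForce.zero (Icc 0 1) (wit c) t x =
      (3 * lam0 * t ^ 2 + a lam0 t) * Lψ x - lam0 * a2 lam0 t * ψ x
        - lam0 * (a lam0 t * a1 lam0 t) * Gψ x + lam0 * c * χ x := by
  have hsum : ∑ k, pd (fun y => wv t y k) k x = a lam0 t * Lψ x := by
    simp only [pd_wv]; rw [Lψ, Finset.mul_sum]
  simp only [auxResidualP, wit]
  rw [(hasDerivAt_wP c t x).hasDerivWithinAt.derivWithin (uniqueDiffOn_Icc zero_lt_one t ht), hsum]
  simp only [AuxForce.zero]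
  ring

/-! ### Signs: the `p`- and `Υ`-rows of `V_{c₀}` are nonnegative, the zero field has zero residual -/

/-- The `p`-row of `V_{c₀}` is `≥ 0` on `[0,1] × ℝ³`: inside `‖x‖ ≤ 2` (`χ = 1`) the constant `λ₀c₀`
dominates the bounded `ψ`-terms; outside, only `λ₀c₀χ ≥ 0` remains. [folklore] -/
theorem residualP_wit_nonneg {t : ℝ} (ht : t ∈ Icc (0 : ℝ) 1) (x : R3) :
    0 ≤ auxResidualP lam0 AuxForce.zero (Icc 0 1) (wit c₀) t x := by
  rw [residualP_wit c₀ ht x]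
  obtain ⟨ht0, ht1⟩ := ht
  have hCL := CL_spec
  have hCG := CG_spec
  by_cases hx : ‖x‖ ≤ 2
  · rw [χ_one_of hx, mul_one]
    have ht2 : t ^ 2 ≤ 1 := by nlinarith
    have ht3 : t ^ 3 ≤ 1 := by nlinarith
    have hu1 : 0 ≤ 3 * lam0 * t ^ 2 + a lam0 t := by unfold lam0 a; positivity
    have hu1' : 3 * lam0 * t ^ 2 + a lam0 t ≤ 7 / 4 := by unfold lam0 a; nlinarith
    have hu2 : 0 ≤ lam0 * a2 lam0 t := by unfold lam0 a2; positivity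
    have hu2' : lam0 * a2 lam0 t ≤ 27 / 32 := by unfold lam0 a2; nlinarith
    have hu3 : 0 ≤ lam0 * (a lam0 t * a1 lam0 t) := by unfold lam0 a a1; positivity
    have hu3' : lam0 * (a lam0 t * a1 lam0 t) ≤ 165 / 256 := by
      unfold lam0 a a1
      have h1 : t ^ 3 + 3 * (1 / 8) * t ^ 2 ≤ 11 / 8 := by nlinarith
      have h2 : 3 * t ^ 2 + 6 * (1 / 8) * t ≤ 15 / 4 := by nlinarith
      have h1' : 0 ≤ t ^ 3 + 3 * (1 / 8) * t ^ 2 := by positivity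
      have h2' : 0 ≤ 3 * t ^ 2 + 6 * (1 / 8) * t := by positivity
      nlinarith [mul_le_mul h1 h2 h2' (by norm_num)]
    have b1 := neg_mul_le_of_abs_le hu1 hu1' (hCL.2 x)
    have b2 := mul_le_of_abs_le hu2 hu2' (abs_ψ_le x)
    have b3 := mul_le_of_abs_le hu3 hu3' (hCG.2 x)
    have hc : lam0 * c₀ = (14 * CL + 7 + 6 * CG) / 8 := by unfold lam0 c₀; ring
    linarith [hCL.1, hCG.1]
  · have hx : 2 < ‖x‖ := not_le.1 hx
    rw [ψ_zero_of hx, Lψ_zero_of hx, Gψ_zero_of hx]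
    have h := mul_nonneg (mul_nonneg lam0_pos.le c₀_nonneg) (χ_nonneg x)
    linarith

/-- The `Υᵢⱼ`-rows of `V_c` are `≥ 0` for `c ≥ 0`. [folklore] -/
theorem residualΥ_wit_nonneg {c : ℝ} (hc : 0 ≤ c) {t : ℝ} (ht : t ∈ Icc (0 : ℝ) 1) (x : R3) (i j : Fin 3) :
    0 ≤ auxResidualΥ lam0 (Icc 0 1) (wit c) t x i j := by
  rw [residualΥ_wit c ht x i j]
  have h1 := δ_nonneg i j
  have h2 := χ_nonneg x
  have h3 : 0 ≤ lam0 + t := by linarith [lam0_pos, ht.1]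
  exact mul_nonneg (mul_nonneg (mul_nonneg h1 hc) h3) h2

/-- `L_{λ₀}(V_{c₀}) ≥ 0` componentwise on `[0,1] × ℝ³` (the witness is a classical supersolution of the
homogeneous system). [folklore] -/
theorem residualNonneg_wit : ResidualNonneg lam0 AuxForce.zero (Icc 0 1) (wit c₀) :=
  fun _ ht x =>
    ⟨residualP_wit_nonneg ht x, fun i => (residualV_wit c₀ ht x i).ge,
      fun i j => residualΥ_wit_nonneg c₀_nonneg ht x i j⟩

/-- The zero field has zero residual for `F = 0`. [folklore] -/
theorem residual_zeroField (lam : ℝ) (S : Set ℝ) (t : ℝ) (x : R3) :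
    auxResidualP lam AuxForce.zero S zeroField t x = 0 ∧
      (∀ i, auxResidualV AuxForce.zero S zeroField t x i = 0) ∧
      ∀ i j, auxResidualΥ lam S zeroField t x i j = 0 := by
  simp [auxResidualP, auxResidualV, auxResidualΥ, zeroField, AuxForce.zero, pd]

/-- The zero field is a classical subsolution (residual `≤ 0`) for `F = 0`. [folklore] -/
theorem residualNonpos_zeroField (lam : ℝ) (S : Set ℝ) : ResidualNonpos lam AuxForce.zero S zeroField := by
  intro t _ x
  obtain ⟨h1, h2, h3⟩ := residual_zeroField lam S t x
  exact ⟨h1.le, fun i => (h2 i).le, fun i j => (h3 i j).le⟩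

/-! ### Regularity of the comparands (C² on the slab, bounded, `H^{2,2}`) and their data -/

/-- `P` is jointly smooth. [folklore] -/
theorem contDiff_wP (c : ℝ) : ContDiff ℝ ∞ (uncurry (wP c)) := by
  have hθ : ContDiff ℝ ∞ (fun q : ℝ × R3 => θ q.1) := by unfold θ; fun_prop
  have ha : ContDiff ℝ ∞ (fun q : ℝ × R3 => a lam0 q.1) := by unfold a; fun_prop
  have ha1 : ContDiff ℝ ∞ (fun q : ℝ × R3 => a1 lam0 q.1) := by unfold a1; fun_prop
  have hct : ContDiff ℝ ∞ (fun q : ℝ × R3 => c * q.1) := by fun_prop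
  exact (((hθ.mul (contDiff_Lψ.comp contDiff_snd)).sub (ha1.mul ((contDiffAll_ψ ⊤).comp contDiff_snd))).sub
    (((ha.mul ha).div_const 2).mul (contDiff_Gψ.comp contDiff_snd))).add
    (hct.mul ((contDiffAll_χ ⊤).comp contDiff_snd))

/-- `vᵢ` is jointly smooth. [folklore] -/
theorem contDiff_wv (i : Fin 3) : ContDiff ℝ ∞ (uncurry fun t x => wv t x i) := by
  have ha : ContDiff ℝ ∞ (fun q : ℝ × R3 => a lam0 q.1) := by unfold a; fun_prop
  exact ha.mul ((contDiff_dψ i).comp contDiff_snd)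

/-- `Υᵢₖ` is jointly smooth. [folklore] -/
theorem contDiff_wΥ (c : ℝ) (i k : Fin 3) : ContDiff ℝ ∞ (uncurry fun t x => wΥ c t x i k) := by
  have hθ : ContDiff ℝ ∞ (fun q : ℝ × R3 => θ q.1) := by unfold θ; fun_prop
  have hct : ContDiff ℝ ∞ (fun q : ℝ × R3 => c * q.1) := by fun_prop
  exact (hθ.mul ((contDiff_ddψ i k).comp contDiff_snd)).add
    (contDiff_const.mul (hct.mul ((contDiffAll_χ ⊤).comp contDiff_snd)))

/-- `P` vanishes for `‖x‖ > 3`. [folklore] -/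
theorem wP_zero (c t : ℝ) {x : R3} (hx : 3 < ‖x‖) : wP c t x = 0 := by
  have hx2 : 2 < ‖x‖ := by linarith
  simp [wP, ψ_zero_of hx2, Lψ_zero_of hx2, Gψ_zero_of hx2, χ_zero_of hx]

/-- `vᵢ` vanishes for `‖x‖ > 3`. [folklore] -/
theorem wv_zero (t : ℝ) {x : R3} (hx : 3 < ‖x‖) (i : Fin 3) : wv t x i = 0 := by
  simp [wv, dψ_zero_of i (by linarith : 2 < ‖x‖)]

/-- `Υᵢₖ` vanishes for `‖x‖ > 3`. [folklore] -/
theorem wΥ_zero (c t : ℝ) {x : R3} (hx : 3 < ‖x‖) (i k : Fin 3) : wΥ c t x i k = 0 := by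
  simp [wΥ, ddψ_zero_of i k (by linarith : 2 < ‖x‖), χ_zero_of hx]

/-- The witness is `C²` on every slab. [folklore] -/
theorem isCk_wit (c : ℝ) (S : Set ℝ) : (wit c).IsCk 2 S :=
  ⟨isCkOnSlab_of_contDiff (contDiff_wP c) S, fun i => isCkOnSlab_of_contDiff (contDiff_wv i) S,
    fun i k => isCkOnSlab_of_contDiff (contDiff_wΥ c i k) S⟩

/-- The witness is bounded on `[0,1] × ℝ³`. [folklore] -/
theorem isBounded_wit (c : ℝ) : (wit c).IsBounded (Icc 0 1) := by
  obtain ⟨MP, hMP0, hMP⟩ :=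
    exists_boundedBySlab (T := 1) (contDiff_wP c).continuous fun t _ hx => wP_zero c t hx
  have hv := fun i : Fin 3 =>
    exists_boundedBySlab (T := 1) (contDiff_wv i).continuous fun t _ hx => wv_zero t hx i
  have hΥ := fun i k : Fin 3 =>
    exists_boundedBySlab (T := 1) (contDiff_wΥ c i k).continuous fun t _ hx => wΥ_zero c t hx i k
  choose Mv hMv0 hMv using hv
  choose MΥ hMΥ0 hMΥ using hΥ
  have hs1 : 0 ≤ ∑ i, Mv i := Finset.sum_nonneg fun i _ => hMv0 i
  have hs2 : ∀ i, 0 ≤ ∑ k, MΥ i k := fun i => Finset.sum_nonneg fun k _ => hMΥ0 i k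
  have hs3 : 0 ≤ ∑ i, ∑ k, MΥ i k := Finset.sum_nonneg fun i _ => hs2 i
  refine ⟨MP + ∑ i, Mv i + ∑ i, ∑ k, MΥ i k, fun t ht x => ?_, fun i t ht x => ?_, fun i k t ht x => ?_⟩
  · have h1 : |wP c t x| ≤ MP := hMP t ht x
    show |wP c t x| ≤ _
    linarith
  · have h1 : |wv t x i| ≤ Mv i := hMv i t ht x
    have h2 : Mv i ≤ ∑ i, Mv i := Finset.single_le_sum (fun i _ => hMv0 i) (Finset.mem_univ i)
    show |wv t x i| ≤ _
    linarith
  · have h1 : |wΥ c t x i k| ≤ MΥ i k := hMΥ i k t ht x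
    have h2 : MΥ i k ≤ ∑ k, MΥ i k := Finset.single_le_sum (fun k _ => hMΥ0 i k) (Finset.mem_univ k)
    have h3 : ∑ k, MΥ i k ≤ ∑ i, ∑ k, MΥ i k :=
      Finset.single_le_sum (f := fun i => ∑ k, MΥ i k) (fun i _ => hs2 i) (Finset.mem_univ i)
    show |wΥ c t x i k| ≤ _
    linarith

/-- The witness is in `H^{2,2}` of `[0,1] × ℝ³`. [folklore] -/
theorem isH22_wit (c : ℝ) : (wit c).IsH22 (Icc 0 1) :=
  ⟨isH22OnSlab_of_support one_pos (contDiff_wP c) fun t _ hx => wP_zero c t hx,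
    fun i => isH22OnSlab_of_support one_pos (contDiff_wv i) fun t _ hx => wv_zero t hx i,
    fun i k => isH22OnSlab_of_support one_pos (contDiff_wΥ c i k) fun t _ hx => wΥ_zero c t hx i k⟩

/-- The zero field is `C²` on every slab. [folklore] -/
theorem isCk_zeroField (S : Set ℝ) : zeroField.IsCk 2 S :=
  ⟨isCkOnSlab_of_contDiff (W := fun _ _ => (0 : ℝ)) contDiff_const S,
    fun _ => isCkOnSlab_of_contDiff (W := fun _ _ => (0 : ℝ)) contDiff_const S,
    fun _ _ => isCkOnSlab_of_contDiff (W := fun _ _ => (0 : ℝ)) contDiff_const S⟩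

/-- The zero field is bounded. [folklore] -/
theorem isBounded_zeroField (S : Set ℝ) : zeroField.IsBounded S :=
  ⟨0, fun _ _ _ => by simp [zeroField], fun _ _ _ _ => by simp [zeroField],
    fun _ _ _ _ _ => by simp [zeroField]⟩

/-- The zero field is in `H^{2,2}` of `[0,1] × ℝ³`. [folklore] -/
theorem isH22_zeroField : zeroField.IsH22 (Icc 0 1) :=
  ⟨isH22OnSlab_of_support (W := fun _ _ => (0 : ℝ)) (R := 0) one_pos contDiff_const fun _ _ _ => rfl,
    fun _ => isH22OnSlab_of_support (W := fun _ _ => (0 : ℝ)) (R := 0) one_pos contDiff_const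
      fun _ _ _ => rfl,
    fun _ _ => isH22OnSlab_of_support (W := fun _ _ => (0 : ℝ)) (R := 0) one_pos contDiff_const
      fun _ _ _ => rfl⟩

/-- The witness has zero data at `t̂ = 0` (`θ(0) = a(0) = a′(0) = 0`). [folklore] -/
theorem slice_wit (c : ℝ) : (wit c).slice 0 = W₀zero := by
  simp only [AuxField.slice, wit, W₀zero, AuxData.mk.injEq]
  refine ⟨?_, ?_, ?_⟩
  · funext x; simp [wP, θ, a, a1]
  · funext x i; simp [wv, a]
  · funext x i k; simp [wΥ, θ]

/-- The zero field has zero data. [folklore] -/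
theorem slice_zeroField : zeroField.slice 0 = W₀zero := rfl

/-! ### The refutations -/

/-- **C06 downstream addendum: the comparison principle [Sm3] Thm 4 AS INVOKED in the proof of Thm 4 p. 4
(system (6), classical comparands, `L_λ(V₁) − F ≥ 0 ≥ L_λ(V₂) − F`, equal admissible data) is false.**
Countermodel: `λ = 1/8`, `t̂ = 0`, `S = [0,1]`, `F = 0`, `W₀ = 0`; `V₂ = 0` (residual `= 0`) and
`V₁ = V_{c₀}` with `vᵢ = a(t)∂ᵢψ`, `Υᵢₖ = t³∂ₖ∂ᵢψ + δᵢₖc₀tχ`, `P = t³Δψ − a′ψ − (a²/2)|∇ψ|² + c₀tχ`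
(`a = t³ + 3λt²`, `ψ` a bump, `χ` a wider bump): its `vᵢ`-rows vanish identically, its `Υ`-rows equal
`δᵢₖc₀(λ+t)χ ≥ 0`, its `p`-row is `≥ 0` by the choice of `c₀`; all components are smooth, compactly
supported in `x`, zero at `t = 0`. Yet `v₀(1, x) = a(1)∂₀ψ(x) < 0 = V₂` somewhere: `V₂ ≤ V₁` fails.
(System (6) is a symmetric-hyperbolic relaxation system, not a parabolic or monotone one; no maximum
principle is available for it.) [cite: Smith2006, Thm 4 proof p.4 l.364–367]
[cite: Smith2006PerronGeneral, Thm 4 p.10 and Remark p.11] -/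
theorem not_ComparisonAuxClassical : ¬ ComparisonAuxClassical := by
  intro h
  obtain ⟨x₀, hx₀⟩ := exists_dψ_neg
  have hB := h lam0 0 (Icc 0 1) W₀zero AuxForce.zero lam0_pos lam0_lt le_rfl (isTimeSlab_Icc one_pos)
    W₀zero_isAdmissible (AuxForce.isAdmissible_zero _) (wit c₀) zeroField (isCk_wit c₀ _)
    (isBounded_wit c₀) (isH22_wit c₀) residualNonneg_wit (isCk_zeroField _) (isBounded_zeroField _)
    isH22_zeroField (residualNonpos_zeroField lam0 _) (slice_wit c₀) slice_zeroField
  have h1 : (0 : ℝ) ≤ a lam0 1 * dψ 0 x₀ := (hB 1 ⟨zero_le_one, le_rfl⟩ x₀).2.1 0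
  have ha : a lam0 1 = 11 / 8 := by norm_num [a, lam0]
  rw [ha] at h1
  linarith

/-- The same countermodel with the roles exchanged refutes the LITERAL-sign variant ([Sm3] Thm 4 p. 10:
`L(V₁) − F ≤ 0` on top): `V₁ = 0`, `V₂ = V_{c₀}`, and `v₀(1, x) = a(1)∂₀ψ(x) > 0 = V₁` somewhere.
[cite: Smith2006PerronGeneral, Thm 4 p.10] -/
theorem not_ComparisonAuxClassicalFlipped : ¬ ComparisonAuxClassicalFlipped := by
  intro h
  obtain ⟨x₁, hx₁⟩ := exists_dψ_pos
  have hB := h lam0 0 (Icc 0 1) W₀zero AuxForce.zero lam0_pos lam0_lt le_rfl (isTimeSlab_Icc one_pos)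
    W₀zero_isAdmissible (AuxForce.isAdmissible_zero _) zeroField (wit c₀) (isCk_zeroField _)
    (isBounded_zeroField _) isH22_zeroField (residualNonpos_zeroField lam0 _) (isCk_wit c₀ _)
    (isBounded_wit c₀) (isH22_wit c₀) residualNonneg_wit slice_zeroField (slice_wit c₀)
  have h1 : a lam0 1 * dψ 0 x₁ ≤ (0 : ℝ) := (hB 1 ⟨zero_le_one, le_rfl⟩ x₁).2.1 0
  have ha : a lam0 1 = 11 / 8 := by norm_num [a, lam0]
  rw [ha] at h1
  linarith

/-- Hence the notion-level principle `ComparisonAux vn` (the second input of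
`theorem4Bounds_of_barriers_comparison`) fails for EVERY `PViscosityNotion` — each such notion contains
the classical super/subsolutions. [cite: Smith2006, Thm 4 proof p.4 l.364–367] -/
theorem not_ComparisonAux (vn : PViscosityNotion) : ¬ ComparisonAux vn :=
  fun h => not_ComparisonAuxClassical (comparisonAuxClassical_of vn h)

end Summit.NavierStokesRegularity.NavierStokesRegularity.Theorems.Smith2006

end
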